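import Summits.AnomalousDissipation.AnomalousDissipation.Theorems.MomentParityMomentClosure
import Summits.AnomalousDissipation.AnomalousDissipation.Theorems.QuarticGate.Negative.LevelCeiling

/-!
# Stub `stub_closure` (S1) of the line `Sketch` for the crux `MomentParity.UniformResolution`
# (stmt-AnomalousDissipation-14330)

**Closure in the moment order at fixed level.** At fixed `(f, ν, N, E, ε, R)`: if for every moment
order `d` there is a level-`N` probability law on `H = L²_σ(T³)` carried by the ball `‖u‖ ≤ R`,
`d`-stationary for Galerkin NS (every polynomial cylindrical observable of total degree `≤ d - 1` with
level-`N` band tests is drift-free), with mean energy `≤ E` and dissipation `≥ ε`, then there is ONE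
such law which is polynomially stationary at EVERY order `d`.

This is `Summit.AnomalousDissipation.AnomalousDissipation.Theorems.momentClosure_proof`
(`Theorems/MomentParityMomentClosure.lean`) without the resolution clause `κ` and without the `C¹`
cylindrical upgrade — its steps 1–3 verbatim:
1. CARRIER. Every `μ_d` is carried by the compact level ball `K = {u level-N, ‖u‖ ≤ R}`
   (`MomentParityMomentClosure.isCompact_levelBall`).
2. LIMIT. `MomentParityMomentClosure.exists_limit_measure_of_isCompact` gives a probability law `μ'`
   carried by `K` with `∫ F dμ' ∈ C` whenever `F : H → ℝ` is continuous, `C` closed and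
   `∫ F dμ_d ∈ C` eventually in `d`.
3. ROWS. The tested generator `u ↦ ⟨F(u), ∇p(u)⟩` of a polynomial observable is continuous on `H`
   (`continuous_nsGeneratorPairing_polyGrad`) and its row vanishes for `μ_d` as soon as `d > deg p`;
   the energy `‖u‖²` is continuous; on `K` the enstrophy is the continuous band sum
   (`lintegral_eGradNormSq_eq`). All three pass to `μ'` by step 2.

Vocabulary: the signature is stated with `QuarticGate.Negative.{IsLevel, IsBandTest, polyGrad,
IsPolyStationary}` (`Theorems/QuarticGate/Negative/LevelCeiling.lean`), the helper lemmas with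
`CubicParityLoud.Negative.{IsLevel, polyGrad}` (`Theorems/CubicParityLoud/Negative/Clauses.lean`); the
two families have identical bodies, so the bridge is definitional unfolding.
-/

noncomputable section

-- Summit.<Summit>.<Problem> duplicate namespace is the tree's mandated layout for single-conjunct summits.
set_option linter.dupNamespace false

namespace Summit.AnomalousDissipation.AnomalousDissipation.Theorems.MomentParityUniformResolution

open MeasureTheory Filter Topology
open scoped ENNReal
open Literature.Analysis.FunctionSpaces Literature.Analysis.FluidPDE
open Summit.AnomalousDissipation.AnomalousDissipation.Theses.MomentParity
open Summit.AnomalousDissipation.AnomalousDissipation.Theorems.QuarticGate.Negative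

/-! ## The two vocabularies agree definitionally -/

/-- The level clause of `QuarticGate.Negative` is the level clause of `CubicParityLoud.Negative`
(identical bodies). [folklore] -/
theorem isLevel_iff (N : ℕ) (u : Torus.energySpace (Fin 3)) :
    IsLevel N u ↔ CubicParityLoud.Negative.IsLevel N u :=
  Iff.rfl

/-! ## S1 — closure in the moment order at fixed level -/

/-- **S1 `stub_closure`.** At fixed `(f, ν, N, E, ε, R)`: loud `d`-stationary level-`N` laws in the
ball `‖u‖ ≤ R` for every order `d` give ONE loud level-`N` law in the same ball that is polynomially
stationary at EVERY order (weak-* compactness on the compact level ball; every polynomial row, the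
energy and the band enstrophy are continuous there — steps 1–3 of the tree's `momentClosure_proof`). -/
theorem stub_closure (f : UnitAddTorus (Fin 3) → EuclideanSpace ℝ (Fin 3)) (hf : Torus.IsSmooth f)
    (ν : ℝ) (N : ℕ) (E ε R : ℝ)
    (hd : ∀ d : ℕ, ∃ μ : Measure (Torus.energySpace (Fin 3)), IsProbabilityMeasure μ ∧ (∀ᵐ u ∂μ, IsLevel N u) ∧
      (∀ᵐ u ∂μ, ‖u‖ ≤ R) ∧ IsPolyStationary ν f N d μ ∧
      Torus.ensembleEnergy μ ≤ E ∧ ε ≤ Torus.ensembleDissipation ν μ) :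
    ∃ μ : Measure (Torus.energySpace (Fin 3)), IsProbabilityMeasure μ ∧ (∀ᵐ u ∂μ, IsLevel N u) ∧ (∀ᵐ u ∂μ, ‖u‖ ≤ R) ∧
      (∀ d : ℕ, IsPolyStationary ν f N d μ) ∧
      Torus.ensembleEnergy μ ≤ E ∧ ε ≤ Torus.ensembleDissipation ν μ := by
  choose μ hμP hμL hμR hμS hμE hμD using hd
  have hfi : Integrable f volume := hf.integrable
  -- the support radius is nonnegative (the measures are probability measures)
  have hR : 0 ≤ R := by
    haveI := hμP 0
    obtain ⟨u, hu⟩ := (hμR 0).exists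
    exact (norm_nonneg u).trans hu
  -- 1. the compact carrier (in the `CubicParityLoud.Negative` vocabulary of the helper lemmas)
  set K : Set (Torus.energySpace (Fin 3)) :=
    {u | CubicParityLoud.Negative.IsLevel N u ∧ ‖u‖ ≤ R} with hK_def
  have hK : IsCompact K := MomentParityMomentClosure.isCompact_levelBall N hR
  have hμK : ∀ d, ∀ᵐ u ∂μ d, u ∈ K := fun d =>
    ((hμL d).and (hμR d)).mono fun u hu => ⟨(isLevel_iff N u).1 hu.1, hu.2⟩
  -- 2. the limit measure
  obtain ⟨μ', hμ'P, hμ'K, hlim⟩ :=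
    MomentParityMomentClosure.exists_limit_measure_of_isCompact hK μ hμP hμK
  haveI := hμ'P
  haveI : ∀ d, IsProbabilityMeasure (μ d) := hμP
  refine ⟨μ', hμ'P, hμ'K.mono fun u hu => (isLevel_iff N u).2 hu.1, hμ'K.mono fun u hu => hu.2,
    fun d m g P hband _hdeg => ?_, ?_, ?_⟩
  · -- 3a. generator rows: polynomial tests pass to the limit (the row of `μ d'` vanishes once
    -- `d' > deg P`)
    have hg : ∀ i, Torus.IsSmooth (g i) := fun i => (hband i).1
    have hc : Continuous fun u : Torus.energySpace (Fin 3) =>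
        Torus.nsGeneratorPairing ν f u (polyGrad g P u) :=
      MomentParityMomentClosure.continuous_nsGeneratorPairing_polyGrad ν hfi hg P
    refine ⟨MomentParityMomentClosure.integrable_of_continuous_of_ae_mem hK hμ'K hc,
      hlim _ hc {0} isClosed_singleton ?_⟩
    filter_upwards [eventually_ge_atTop (P.totalDegree + 1)] with d' hd'
    exact (hμS d' m g P hband hd').2
  · -- 3b. mean energy
    exact hlim (fun u => ‖u‖ ^ 2) (continuous_norm.pow 2) (Set.Iic E) isClosed_Iic
      (Eventually.of_forall fun d => hμE d)
  · -- 3c. dissipation: on `K` the enstrophy is the continuous level-`N` band sum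
    have hcl : IsClosed {t : ℝ | ε ≤ ν * t} :=
      isClosed_le continuous_const (continuous_const.mul continuous_id)
    have key := hlim _ (MomentParityMomentClosure.continuous_bandEnstrophy (Torus.freqBall N)) _ hcl
      (Eventually.of_forall fun d => by
        have h := hμD d
        rw [Torus.ensembleDissipation, Torus.ensembleEnstrophy,
          MomentParityMomentClosure.lintegral_eGradNormSq_eq hR (hμK d),
          ENNReal.toReal_ofReal
            (integral_nonneg (MomentParityMomentClosure.bandEnstrophy_nonneg _))] at h
        exact h)
    rw [Torus.ensembleDissipation, Torus.ensembleEnstrophy,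
      MomentParityMomentClosure.lintegral_eGradNormSq_eq hR hμ'K,
      ENNReal.toReal_ofReal (integral_nonneg (MomentParityMomentClosure.bandEnstrophy_nonneg _))]
    exact key

end Summit.AnomalousDissipation.AnomalousDissipation.Theorems.MomentParityUniformResolution

end
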